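import Summits.ValiantsHypothesis.ValiantsHypothesis.Theorems.SymPencilPerFourHyperplaneQuad
import Summits.ValiantsHypothesis.ValiantsHypothesis.Theorems.SymPencilPerFourBoxInjective

/-!
# Route `SymPencil` — the quadratic permanent lemma with the LAST row on a hyperplane
# (tool file for the hyperplane flow rigidity of `per [𝟙; ·]`, size-`27` cell `(12,4,2)` of
# `sdc(per_4)`, `--supports` stmt-ValiantsHypothesis-5674; rung currency only, nothing here bears
# on `VP ≠ VNP`)

`SymPencilPerFourRowStabilizer.eq_zero_of_perm_quad`: a linear `Y` on `K⁴` with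
`per [v; Y u; u; z] = 0` for all `u, z` vanishes.  For the off-diagonal blocks of a flow symmetry
of `F = per [𝟙; ·]` on a HYPERPLANE `ker ℓ ⊂ K^{3×4}` (`SymPencilPerFourHyperplaneFlow*`) one only
controls `z` in a hyperplane of `K⁴`, or `u` in a hyperplane of `K⁴`.  The `u`-restricted version is
`SymPencilPerFourHyperplaneQuad.eq_zero_on_ker_of_perm_quad` (val-lit-p4 g14, any `v`); this file
is the `z`-restricted version at the base row `𝟙`:

* `eq_zero_of_perm_quad_ker`: if `per [𝟙; Y u; u; z] = 0` for all `u` and all `z ∈ ker μ`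
  (`μ` arbitrary), then `Y = 0`.  Proof: cross-multiplying the coordinate slices
  (`μ_q Q_p = μ_p Q_q`, `Q_p(u) = per [𝟙; Yu; u; e_p]`) makes every `Y e_i` a multiple `η_i e_i`
  (`eq_zero_of_perm_single`), and the pair relations `μ_a (η_a + η_b) = 0`,
  `(μ_p - μ_q)(η_a + η_b) = 0` kill `η`.
Characteristic `0`; no definitions, no named facts. [folklore]
-/

noncomputable section

-- single-conjunct layout: Sub = Summit, duplicated namespace component intended
set_option linter.dupNamespace false

namespace Summit.ValiantsHypothesis.ValiantsHypothesis.Theorems.SymPencilPerFourHyperplaneQuadKer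

open Matrix
open Summit.ValiantsHypothesis.ValiantsHypothesis.Theorems.SymPencilPerFourInnerRankRows
open Summit.ValiantsHypothesis.ValiantsHypothesis.Theorems.SymPencilPerFourRowForms
open Summit.ValiantsHypothesis.ValiantsHypothesis.Theorems.SymPencilPerFourRowStabilizer
open Summit.ValiantsHypothesis.ValiantsHypothesis.Theorems.SymPencilPerFourBoxInjective
open Summit.ValiantsHypothesis.ValiantsHypothesis.Theorems.SymPencilPerFourHyperplaneQuad

variable {K : Type*} [Field K]

/-! ### Bookkeeping for the base row `𝟙` -/

/-- Linearity of `per [v; a; b; z]` in the last row, against the coordinate rows. [folklore] -/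
theorem per_eq_sum_row₃ (v a b z : Fin 4 → K) :
    (Matrix.of ![v, a, b, z]).permanent =
      ∑ q : Fin 4, z q * (Matrix.of ![v, a, b, Pi.single q 1]).permanent := by
  simp [permanent_of_rows, Fin.sum_univ_four]
  ring

/-- Two equal coordinate rows in the slots `2, 4` (other order) kill the permanent. [folklore] -/
theorem permanent_rows_rep₁₃ (v w : Fin 4 → K) (i : Fin 4) :
    (Matrix.of ![v, Pi.single i 1, w, Pi.single i 1]).permanent = 0 := by
  rw [per_swap_row₂₃]
  fin_cases i <;> simp [permanent_of_rows]

/-- `per [𝟙; e_a; e_b; e_p] = 1` for distinct `a, b, p`. [folklore] -/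
theorem permanent_ones_three_single (a b p q : Fin 4)
    (h : a ≠ b ∧ a ≠ p ∧ a ≠ q ∧ b ≠ p ∧ b ≠ q ∧ p ≠ q) :
    (Matrix.of ![(fun _ => (1 : K)), Pi.single a 1, Pi.single b 1, Pi.single p 1]).permanent
      = 1 :=
  permanent_rows_three_single (fun _ => (1 : K)) a b p q h

variable [CharZero K]

/-! ### Version 2: `z` in a hyperplane -/

/-- **The quadratic permanent lemma with `z` restricted to a hyperplane.**  See the module
docstring. [folklore] -/
theorem eq_zero_of_perm_quad_ker (μ : (Fin 4 → K) →ₗ[K] K)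
    (Y : (Fin 4 → K) →ₗ[K] (Fin 4 → K))
    (h : ∀ u z : Fin 4 → K, μ z = 0 →
      (Matrix.of ![(fun _ => (1 : K)), Y u, u, z]).permanent = 0) :
    Y = 0 := by
  have hv : ∀ j : Fin 4, (fun _ => (1 : K)) j ≠ 0 := fun _ => one_ne_zero
  by_cases hμ : μ = 0
  · exact eq_zero_of_perm_quad hv Y fun y z => h y z (by rw [hμ, LinearMap.zero_apply])
  -- coordinates of `μ` and the cross-multiplied slices
  set m : Fin 4 → K := fun k => μ (Pi.single k 1) with hm
  have hμc : ∀ c : Fin 4 → K, μ c = m ⬝ᵥ c := apply_eq_dotProduct μ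
  obtain ⟨i₀, hi₀⟩ : ∃ i₀, m i₀ ≠ 0 := by
    by_contra hn
    push Not at hn
    apply hμ
    apply (Pi.basisFun K (Fin 4)).ext
    intro i
    rw [Pi.basisFun_apply, LinearMap.zero_apply]
    exact hn i
  have hstar : ∀ (p q : Fin 4) (u : Fin 4 → K),
      m q * (Matrix.of ![(fun _ => (1 : K)), Y u, u, Pi.single p 1]).permanent =
        m p * (Matrix.of ![(fun _ => (1 : K)), Y u, u, Pi.single q 1]).permanent := by
    intro p q u
    have hz : μ (m q • Pi.single p 1 - m p • Pi.single q 1) = 0 := by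
      rw [hμc, dotProduct_sub, dotProduct_smul, dotProduct_smul, dotProduct_single,
        dotProduct_single]
      simp only [smul_eq_mul, mul_one]; ring
    have e := h u _ hz
    rw [per_eq_sum_row₃] at e
    simp only [Fin.sum_univ_four, Pi.sub_apply, Pi.smul_apply, Pi.single_apply, smul_eq_mul]
      at e
    fin_cases p <;> fin_cases q <;> simp at e ⊢ <;> linear_combination e
  -- Step 1: `per [𝟙; Y e_i; e_i; e_q] = 0`
  have hdiag : ∀ i q : Fin 4,
      (Matrix.of ![(fun _ => (1 : K)), Y (Pi.single i 1), Pi.single i 1, Pi.single q 1]).permanent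
        = 0 := by
    intro i q
    by_cases hi : m i = 0
    · -- the whole slice `Q_i` vanishes
      have hQ : ∀ u : Fin 4 → K,
          (Matrix.of ![(fun _ => (1 : K)), Y u, u, Pi.single i 1]).permanent = 0 := fun u => by
        have e := hstar i i₀ u
        rw [hi, zero_mul] at e
        exact (mul_eq_zero.1 e).resolve_left hi₀
      by_cases hq : q = i
      · rw [hq]; exact permanent_rows_w_single_single _ _ _
      · have e := hQ (Pi.single i 1 + Pi.single q 1)
        rw [map_add, per_add_row₁, per_add_row₂, per_add_row₂] at e
        simp only [hQ, permanent_rows_w_single_single, zero_add, add_zero] at e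
        rwa [per_swap_row₂₃] at e
    · have e := hstar i q (Pi.single i 1)
      rw [permanent_rows_w_single_single, mul_zero] at e
      exact (mul_eq_zero.1 e.symm).resolve_left hi
  -- Step 2: `Y e_i = η_i e_i`
  have hcol : ∀ i p, p ≠ i → Y (Pi.single i 1) p = 0 := fun i =>
    eq_zero_of_perm_single hv i _ fun z => by
      rw [per_eq_sum_row₃]
      simp [hdiag]
  have hYe : ∀ i, Y (Pi.single i 1) = Y (Pi.single i 1) i • (Pi.single i 1 : Fin 4 → K) :=
    fun i => eq_smul_single_of_apply_eq_zero i _ (hcol i)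
  set η : Fin 4 → K := fun i => Y (Pi.single i 1) i with hη
  -- the slices at `e_a + e_b`
  have hQ : ∀ a b p : Fin 4, a ≠ b →
      (Matrix.of ![(fun _ => (1 : K)), Y (Pi.single a 1 + Pi.single b 1),
        Pi.single a 1 + Pi.single b 1, Pi.single p 1]).permanent =
      (η a + η b) *
        (Matrix.of ![(fun _ => (1 : K)), Pi.single a 1, Pi.single b 1, Pi.single p 1]).permanent := by
    intro a b p hab
    rw [map_add, hYe a, hYe b, per_add_row₁, per_add_row₂, per_add_row₂, permanent_rows_smul₁,
      permanent_rows_smul₁, permanent_rows_smul₁, permanent_rows_smul₁, permanent_rows_rep,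
      permanent_rows_rep, permanent_rows_swap₁₂ _ (Pi.single b 1) (Pi.single a 1)]
    ring
  -- Step 3: pair relations `m_a (η_a + η_b) = 0` and `(m_p - m_q)(η_a + η_b) = 0`
  have hC1 : ∀ a b : Fin 4, a ≠ b → m a * (η a + η b) = 0 := by
    intro a b hab
    obtain ⟨p, q, hap, haq, hbp, hbq, hpq⟩ := exists_compl_pair a b hab
    have e := hstar p a (Pi.single a 1 + Pi.single b 1)
    rw [hQ a b p hab, hQ a b a hab, permanent_ones_three_single a b p q ⟨hab, hap, haq, hbp, hbq, hpq⟩,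
      permanent_rows_rep₁₃, mul_zero, mul_zero, mul_one] at e
    exact e
  have hC2 : ∀ a b p q : Fin 4, a ≠ b → a ≠ p → a ≠ q → b ≠ p → b ≠ q → p ≠ q →
      (m p - m q) * (η a + η b) = 0 := by
    intro a b p q hab hap haq hbp hbq hpq
    have e := hstar p q (Pi.single a 1 + Pi.single b 1)
    rw [hQ a b p hab, hQ a b q hab, permanent_ones_three_single a b p q ⟨hab, hap, haq, hbp, hbq, hpq⟩,
      permanent_ones_three_single a b q p ⟨hab, haq, hap, hbq, hbp, hpq.symm⟩] at e
    linear_combination -e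
  -- Step 4: `η = 0`
  have hηb : ∀ b, b ≠ i₀ → η b = -η i₀ := fun b hb => by
    have e := hC1 i₀ b (Ne.symm hb)
    have e' : η i₀ + η b = 0 := (mul_eq_zero.1 e).resolve_left hi₀
    linear_combination e'
  have hη0 : η i₀ = 0 := by
    by_contra hne
    obtain ⟨a, -, hia, -, -⟩ := exists_pair_ne i₀
    obtain ⟨b, q, hib, hiq, hab, haq, hbq⟩ := exists_compl_pair i₀ a hia
    have sab : η a + η b = -2 * η i₀ := by rw [hηb a (Ne.symm hia), hηb b (Ne.symm hib)]; ring
    have saq : η a + η q = -2 * η i₀ := by rw [hηb a (Ne.symm hia), hηb q (Ne.symm hiq)]; ring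
    have hσ : -2 * η i₀ ≠ 0 := mul_ne_zero (by norm_num) hne
    have e1 : m q * (η a + η q) = 0 := by
      have e := hC1 q a (Ne.symm haq)
      rwa [add_comm] at e
    rw [saq] at e1
    have hmq : m q = 0 := (mul_eq_zero.1 e1).resolve_right hσ
    have e2 := hC2 a b i₀ q hab (Ne.symm hia) haq (Ne.symm hib) hbq hiq
    rw [sab, hmq, sub_zero] at e2
    exact hi₀ ((mul_eq_zero.1 e2).resolve_right hσ)
  have hηall : ∀ i, η i = 0 := fun i => by
    by_cases hi : i = i₀
    · rw [hi]; exact hη0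
    · rw [hηb i hi, hη0, neg_zero]
  apply (Pi.basisFun K (Fin 4)).ext
  intro i
  rw [Pi.basisFun_apply, LinearMap.zero_apply, hYe i]
  change η i • (Pi.single i 1 : Fin 4 → K) = 0
  rw [hηall i, zero_smul]

end Summit.ValiantsHypothesis.ValiantsHypothesis.Theorems.SymPencilPerFourHyperplaneQuadKer

end
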